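import Literature.MathematicalPhysics.QuantumLattice.FermionOperators
import HarnessLib

/-!
# Discharge of `parityOp_eq_noncommProd` and `parityOp_mul_annihilation`: the fermion parity

Trunk T-QLATTICE, family `hubbard`. Sibling proof file of
`Literature/MathematicalPhysics/QuantumLattice/FermionOperators.lean`; no statement is introduced
or changed.

Proved here, for the fermionic Fock space `Fock ι = Finset ι → ℂ` of Wave0 with its
Jordan–Wigner matrices `annihilation i = c_i`, `numberAt i = n_i = c†_i c_i` and the parity
`parityOp = (-1)^N` (the diagonal matrix `|s⟩ ↦ (-1)^{#s} |s⟩`):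

* `parityOp_eq_noncommProd_holds` : `(-1)^N = ∏_i (1 - 2 n_i)` (the named fact
  `Literature.MathematicalPhysics.QuantumLattice.parityOp_eq_noncommProd`). Every factor
  `1 - 2 n_i` is diagonal in the occupation basis (`numberAt_eq_diagonal`) with entry `-1` on
  `|s⟩` if `i ∈ s` and `+1` otherwise — the single-mode identity `1 - 2 n_j = e^{iπ n_j}`
  (Essler et al. (2005) §12.4.2, text after (12.259); Fradkin (2013) §5.2.2, (5.90)–(5.91)) —
  so, pushing the ring homomorphism `Matrix.diagonalRingHom` through `Finset.noncommProd`
  (`Finset.map_noncommProd`, `Finset.noncommProd_eq_prod`), the product is the diagonal matrix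
  with entry `∏_i (if i ∈ s then -1 else 1) = (-1)^{#s}`, i.e. `∏_j e^{iπ n_j} = e^{iπ N̂}`
  (Essler et al., loc. cit., (12.260)).
* `parityOp_mul_annihilation_holds` : `(-1)^N c_i = - c_i (-1)^N` (the named fact
  `Literature.MathematicalPhysics.QuantumLattice.parityOp_mul_annihilation`): the only non-zero
  entries of `c_i` are `⟨s| c_i |insert i s⟩ = jwSign i s` with `i ∉ s`, and
  `(-1)^{#s} = -(-1)^{#(insert i s)}`; i.e. `c_i` changes the particle number by one, so it is
  odd under the parity (fermionic operators are "homogeneous with odd parity",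
  Essler et al. (2005) §12.3.1).

## Sources

H. Tasaki, *Physics and Mathematics of Quantum Many-Body Systems* (Springer GTP, 2020) §9.2
(the source cited by the vendored statements; not held at the time of writing — acquisition
requested); F. H. L. Essler, H. Frahm, F. Göhmann, A. Klümper, V. E. Korepin, *The One-Dimensional
Hubbard Model* (CUP 2005) §12.3.1 and §12.4.2, eqs. (12.259)–(12.260) (PDF p. 441:
"`1 - 2n_{j,↓} = e^{iπ n_{j,↓}}`"); E. Fradkin, *Field Theories of Condensed Matter Physics*
(2nd ed., CUP 2013) §5.2.2, eqs. (5.90)–(5.91), (5.100) (PDF p. 98–99).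
-/

namespace Literature.MathematicalPhysics.QuantumLattice

open Matrix Finset HubbardWave0

section Fock

variable {ι : Type*} [LinearOrder ι] [Fintype ι]

/-- `1 - 2 n_i` is the diagonal matrix `|s⟩ ↦ ± |s⟩` with entry `-1` if `i ∈ s` and `+1`
otherwise, i.e. the single-mode identity `1 - 2 n_j = e^{iπ n_j}` of the Jordan–Wigner calculus,
here read off from `numberAt_eq_diagonal` (stated through `Matrix.diagonalRingHom` for use under
`Finset.noncommProd`). Essler et al. (2005) §12.4.2, text after eq. (12.259) (PDF p. 441);
Fradkin (2013) §5.2.2, eqs. (5.90)–(5.91). [cite: EsslerEtAl2005, §12.4.2 after eq. (12.259)] -/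
theorem one_sub_two_smul_numberAt_eq_diagonal (i : ι) :
    (1 : Matrix (Finset ι) (Finset ι) ℂ) - 2 • numberAt i =
      diagonalRingHom (Finset ι) ℂ (fun s => if i ∈ s then -1 else 1) := by
  rw [diagonalRingHom_apply, numberAt_eq_diagonal, ← diagonal_one, ← diagonal_smul, diagonal_sub]
  congr 1
  funext s
  by_cases hi : i ∈ s <;> norm_num [hi]

/-- Discharge of `parityOp_eq_noncommProd`: `(-1)^N = ∏_i (1 - 2 n_i)` on the fermionic Fock
space. All factors are diagonal in the occupation basis (`one_sub_two_smul_numberAt_eq_diagonal`),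
so the (commuting) product is the diagonal matrix with entry
`∏_i (if i ∈ s then -1 else 1) = (-1)^{#s}` on `|s⟩`, which is `parityOp` by definition — the
identity `∏_j (1 - 2 n_j) = ∏_j e^{iπ n_j} = e^{iπ N̂}` of Essler et al. (2005) §12.4.2,
(12.259)–(12.260); Fradkin (2013) §5.2.2, (5.90), (5.100). Tasaki (2020) §9.2.
[cite: Tasaki2020, §9.2] -/
theorem parityOp_eq_noncommProd_holds : parityOp_eq_noncommProd (ι := ι) := by
  unfold parityOp_eq_noncommProd
  rw [Finset.noncommProd_congr rfl (fun i _ => one_sub_two_smul_numberAt_eq_diagonal i),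
    ← Finset.map_noncommProd _ _ (fun _ _ _ _ _ => Commute.all _ _), Finset.noncommProd_eq_prod,
    diagonalRingHom_apply, parityOp]
  congr 1
  funext s
  rw [Finset.prod_apply, Finset.prod_ite_mem, Finset.univ_inter, Finset.prod_const]

/-- Discharge of `parityOp_mul_annihilation`: `(-1)^N c_i = -c_i (-1)^N`, the annihilation
operator is odd under the fermion parity. Entrywise, `⟨s| c_i |t⟩ ≠ 0` forces `i ∉ s` and
`t = insert i s`, where `(-1)^{#s} = -(-1)^{#t}`. Tasaki (2020) §9.2; cf. Essler et al. (2005)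
§12.3.1 (Fermi operators are homogeneous of odd parity). [cite: Tasaki2020, §9.2] -/
theorem parityOp_mul_annihilation_holds : parityOp_mul_annihilation (ι := ι) := by
  intro i
  ext s t
  simp only [parityOp, diagonal_mul, mul_diagonal, Matrix.neg_apply, annihilation]
  split_ifs with h
  · rw [h.2, Finset.card_insert_of_notMem h.1, pow_succ]
    ring
  · simp

end Fock

end Literature.MathematicalPhysics.QuantumLattice
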